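import Summits.CriticalPhenomena.Ising3DConformalLimit.Theorems.MoebiusLimitExists.Negative.RatioRegularCorollaries
import Mathlib.Analysis.BoxIntegral.UnitPartition
import Mathlib.Analysis.Convex.Measure
import Mathlib.MeasureTheory.Measure.Haar.InnerProductSpace
import HarnessLib

/-!
# Riemann sum of the cross term of the layer regression form (stub B1)

Stub `stub_crossTermLimit` (B1) of line `single-layer-linear-regression` for the crux
`GaussianLimitNotScreened` (stmt-CriticalPhenomena-13886). THEOREM-ONLY.

Under the crux hypotheses (a non-degenerate, Möbius-covariant pointwise scaling limit `(ρ, Δ, S)` of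
the critical correlators `criticalCorr 3`; no Gaussianity is used), for every continuous profile `φ`
on `ℝ² = EuclideanSpace ℝ (Fin 2)` vanishing outside the ball of radius `R`,

  `Σ_{u ∈ ℤ², |uᵢ| ≤ Rn} n⁻² φ(u/n) ⟨σ₀σ_{(n,u)}⟩_{β_c} / ⟨σ₀σ_{2n e₀}⟩_{β_c} → 4^Δ ∫ φ(v) (1+|v|²)^{−Δ} dv`.

Mechanism ("the definition of a pointwise scaling limit with dimension `Δ`, read on one lattice
layer"): at mesh `δ = 1/n` the lattice pair `(0, (n,u))` is EXACTLY the lattice approximation of the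
continuum pair `(0, (1, u/n))`, and `(0, 2n e₀)` that of `(0, 2e₀)`; uniform convergence of
`ρ(1/n)² ⟨σ₀σ_·⟩` on the compact set of configurations `(0, (1, w))`, `|wᵢ| ≤ R`, and the explicit
`O(3)`+scale-covariant two-point function `S₂(0, y) = A‖y‖^{−2Δ}` (`two_point_radial`) give
`ρ(1/n)² ⟨σ₀σ_{(n,u)}⟩ → A (1+|u/n|²)^{−Δ}` uniformly in `u` and `ρ(1/n)² ⟨σ₀σ_{2n e₀}⟩ → A 2^{−2Δ}`;
the numerator is then `A` times a two-dimensional Riemann sum of the continuous compactly supported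
`φ · (1+|·|²)^{−Δ}` (Mathlib's `tendsto_tsum_div_pow_atTop_integral` on the box `[−R, R]²`,
transported to `EuclideanSpace ℝ (Fin 2)` by the volume-preserving `WithLp.toLp`), and
`A / (A 2^{−2Δ}) = 4^Δ`.
-/

noncomputable section

namespace Summit.CriticalPhenomena.Ising3DConformalLimit.Cruxes.GaussianLimitNotScreened.SingleLayerLinearRegression

open MeasureTheory Filter Topology
open scoped Pointwise
open Literature.Probability.LatticeModels
open Summit.CriticalPhenomena.Ising3DConformalLimit.MoebiusLimitExistsNegative (two_point_radial)

/-! ### Two-dimensional Riemann sums over the lattice box `[-Rn, Rn]²` -/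

/-- For `u ∈ ℤ²` with `|uᵢ| ≤ Rn` (`n ≥ 1`), the rescaled point `u/n` lies in the box `[-R, R]²`.
[folklore] -/
theorem crossTerm_smul_mem_box {R n : ℕ} (hn : 1 ≤ n) {u : Fin 2 → ℤ}
    (hu : u ∈ Fintype.piFinset (fun _ : Fin 2 => Finset.Icc (-((R * n : ℕ) : ℤ)) ((R * n : ℕ) : ℤ))) :
    ((n : ℝ)⁻¹ • fun i => (u i : ℝ)) ∈ Set.Icc (fun _ : Fin 2 => -(R : ℝ)) (fun _ => (R : ℝ)) := by
  have hn' : (0:ℝ) < n := by exact_mod_cast hn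
  rw [Fintype.mem_piFinset] at hu
  rw [Set.mem_Icc, Pi.le_def, Pi.le_def]
  refine ⟨fun i => ?_, fun i => ?_⟩
  · have h1 : ((-((R * n : ℕ) : ℤ) : ℤ) : ℝ) ≤ u i := by exact_mod_cast (Finset.mem_Icc.1 (hu i)).1
    push_cast at h1
    simp only [Pi.smul_apply, smul_eq_mul]
    rw [← div_le_iff₀' (inv_pos.2 hn'), div_inv_eq_mul]
    linarith
  · have h2 : (u i : ℝ) ≤ (((R * n : ℕ) : ℤ) : ℝ) := by exact_mod_cast (Finset.mem_Icc.1 (hu i)).2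
    push_cast at h2
    simp only [Pi.smul_apply, smul_eq_mul]
    rw [← le_div_iff₀' (inv_pos.2 hn'), div_inv_eq_mul]
    linarith

/-- **Two-dimensional Riemann sums.** For a continuous `F` on `ℝ²` vanishing outside the ball of
radius `R ∈ ℕ`, `Σ_{u ∈ ℤ², |uᵢ| ≤ Rn} n⁻² F(u/n) → ∫ F` (Mathlib's
`tendsto_tsum_div_pow_atTop_integral` on the box `[-R, R]²` of `Fin 2 → ℝ`, whose mesh-`1/n` points
are exactly the `u/n`, `|uᵢ| ≤ Rn`, transported by the volume-preserving `WithLp.toLp`). [folklore] -/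
theorem crossTerm_tendsto_riemann_sum {F : EuclideanSpace ℝ (Fin 2) → ℝ} (hF : Continuous F)
    (R : ℕ) (hFs : ∀ v, (R : ℝ) ≤ ‖v‖ → F v = 0) :
    Tendsto (fun n : ℕ =>
        ∑ u ∈ Fintype.piFinset (fun _ : Fin 2 => Finset.Icc (-((R * n : ℕ) : ℤ)) ((R * n : ℕ) : ℤ)),
          F ((n : ℝ)⁻¹ • (WithLp.toLp 2 fun i => (u i : ℝ))) / (n : ℝ) ^ 2)
      atTop (𝓝 (∫ v, F v)) := by
  classical
  set s : Set (Fin 2 → ℝ) := Set.Icc (fun _ => -(R:ℝ)) (fun _ => (R:ℝ)) with hs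
  set F' : (Fin 2 → ℝ) → ℝ := fun x => F (WithLp.toLp 2 x) with hF'
  have hF'c : Continuous F' := hF.comp (PiLp.continuous_toLp 2 _)
  have h := tendsto_tsum_div_pow_atTop_integral s F' hF'c (Metric.isBounded_Icc _ _)
    measurableSet_Icc ((convex_Icc _ _).addHaar_frontier volume)
  have hint : ∫ x in s, F' x = ∫ v, F v := by
    rw [setIntegral_eq_integral_of_forall_compl_eq_zero]
    · exact (PiLp.volume_preserving_toLp (Fin 2)).integral_comp
        (MeasurableEquiv.toLp 2 (Fin 2 → ℝ)).measurableEmbedding F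
    · intro x hx
      apply hFs
      simp only [hs, Set.mem_Icc, Pi.le_def, not_and_or, not_forall, not_le] at hx
      have habs : ∀ i, |x i| ≤ ‖WithLp.toLp 2 x‖ := fun i => by
        have := PiLp.norm_apply_le (WithLp.toLp 2 x) i
        rwa [Real.norm_eq_abs] at this
      rcases hx with ⟨i, hi⟩ | ⟨i, hi⟩
      · have h2 : (R:ℝ) ≤ |x i| := by
          rw [abs_of_neg (by linarith [(Nat.cast_nonneg R : (0:ℝ) ≤ R)])]; linarith
        exact h2.trans (habs i)
      · exact (hi.le.trans (le_abs_self _)).trans (habs i)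
  rw [hint, Fintype.card_fin] at h
  refine h.congr' ?_
  filter_upwards [eventually_ge_atTop 1] with n hn
  haveI : NeZero n := ⟨by omega⟩
  have hn' : (0:ℝ) < n := by exact_mod_cast hn
  set e : (Fin 2 → ℤ) → (Fin 2 → ℝ) := fun u => (n:ℝ)⁻¹ • fun i => (u i : ℝ) with he
  set B := Fintype.piFinset (fun _ : Fin 2 => Finset.Icc (-((R * n : ℕ) : ℤ)) ((R * n : ℕ) : ℤ))
    with hB
  have hset : (s ∩ (n:ℝ)⁻¹ • (↑(Submodule.span ℤ (Set.range (Pi.basisFun ℝ (Fin 2)))) :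
      Set (Fin 2 → ℝ))) = ↑(B.image e) := by
    ext x
    simp only [Set.mem_inter_iff, Finset.coe_image, Set.mem_image, Finset.mem_coe]
    rw [← Submodule.coe_pointwise_smul, SetLike.mem_coe,
      BoxIntegral.unitPartition.mem_smul_span_iff]
    constructor
    · rintro ⟨hxs, hxL⟩
      choose u hu using hxL
      have hu' : ∀ i, (u i : ℝ) = n * x i := fun i => by simpa using hu i
      rw [hs, Set.mem_Icc, Pi.le_def, Pi.le_def] at hxs
      refine ⟨u, ?_, ?_⟩
      · rw [hB, Fintype.mem_piFinset]
        intro i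
        have h1 := hxs.1 i
        have h2 := hxs.2 i
        rw [Finset.mem_Icc]
        constructor
        · have : ((-((R * n : ℕ) : ℤ) : ℤ) : ℝ) ≤ u i := by rw [hu' i]; push_cast; nlinarith
          exact_mod_cast this
        · have : (u i : ℝ) ≤ (((R * n : ℕ) : ℤ) : ℝ) := by rw [hu' i]; push_cast; nlinarith
          exact_mod_cast this
      · funext i
        simp only [he, Pi.smul_apply, smul_eq_mul, hu' i]
        field_simp
    · rintro ⟨u, hu, rfl⟩
      exact ⟨crossTerm_smul_mem_box hn hu, fun i => ⟨u i, by simp [he, hn'.ne']⟩⟩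
  have hinj : Set.InjOn e ↑B := by
    intro u _ v _ huv
    funext i
    have := congrFun huv i
    simp only [he, Pi.smul_apply, smul_eq_mul, mul_eq_mul_left_iff, inv_eq_zero, hn'.ne',
      or_false, Int.cast_inj] at this
    exact this
  rw [hset, Finset.tsum_subtype', Finset.sum_image hinj, Finset.sum_div]
  refine Finset.sum_congr rfl fun u _ => ?_
  simp only [hF', he, WithLp.toLp_smul]

/-! ### The layer points at mesh `1/n` -/

/-- The lift `x ↦ (1, x) ∈ ℝ³` of the plane `ℝ²` is continuous. [folklore] -/
theorem crossTerm_continuous_lift :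
    Continuous fun x : Fin 2 → ℝ => (WithLp.toLp 2 (Fin.cons 1 x) : EuclideanSpace ℝ (Fin 3)) := by
  refine (PiLp.continuous_toLp 2 _).comp ?_
  refine continuous_pi fun i => ?_
  refine Fin.cases ?_ (fun j => ?_) i
  · simp only [Fin.cons_zero]; exact continuous_const
  · simp only [Fin.cons_succ]; exact continuous_apply j

/-- `‖(1, x)‖² = 1 + ‖x‖²`. [folklore] -/
theorem crossTerm_norm_lift_sq (x : Fin 2 → ℝ) :
    ‖(WithLp.toLp 2 (Fin.cons 1 x) : EuclideanSpace ℝ (Fin 3))‖ ^ 2 = 1 + ‖WithLp.toLp 2 x‖ ^ 2 := by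
  rw [EuclideanSpace.norm_sq_eq, EuclideanSpace.norm_sq_eq, Fin.sum_univ_succ]
  simp

/-- `(1, x) ≠ 0`. [folklore] -/
theorem crossTerm_lift_ne_zero (x : Fin 2 → ℝ) :
    (WithLp.toLp 2 (Fin.cons 1 x) : EuclideanSpace ℝ (Fin 3)) ≠ 0 := by
  intro h
  have := congrArg (fun v : EuclideanSpace ℝ (Fin 3) => v 0) h
  simp at this

/-- At mesh `1/n` the lattice point `(n, u) ∈ ℤ³` rescales EXACTLY to the continuum point
`(1, u/n)`. [folklore] -/
theorem crossTerm_smul_siteVec_cons {n : ℕ} (hn : 1 ≤ n) (u : Fin 2 → ℤ) :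
    (n : ℝ)⁻¹ • siteVec (Fin.cons (n : ℤ) u : Site 3) =
      (WithLp.toLp 2 (Fin.cons 1 ((n : ℝ)⁻¹ • fun i => (u i : ℝ))) : EuclideanSpace ℝ (Fin 3)) := by
  have hn' : (n:ℝ) ≠ 0 := by exact_mod_cast (show n ≠ 0 by omega)
  ext i
  refine Fin.cases ?_ (fun j => ?_) i
  · simp [siteVec_apply, hn']
  · simp [siteVec_apply]

/-- At mesh `1/n` the axis point `2n e₀ ∈ ℤ³` rescales EXACTLY to `2 e₀`. [folklore] -/
theorem crossTerm_smul_siteVec_axis {n : ℕ} (hn : 1 ≤ n) :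
    (n : ℝ)⁻¹ • siteVec (Pi.single 0 ((2 * n : ℕ) : ℤ) : Site 3) =
      EuclideanSpace.single (0 : Fin 3) (2 : ℝ) := by
  have hn' : (n:ℝ) ≠ 0 := by exact_mod_cast (show n ≠ 0 by omega)
  ext i
  by_cases hi : i = 0
  · subst hi
    simp [siteVec_apply]
    field_simp
  · simp [siteVec_apply, hi]

/-- At mesh `δ > 0` the lattice approximation of `(0, δ x̂)` is `(0, x)` exactly, so the rescaled
pair correlator there is `ρ(δ)² ⟨σ₀σ_x⟩_{β_c}`. [folklore] -/
theorem crossTerm_rescaledCorrelator_pair (ρ : ℝ → ℝ) {δ : ℝ} (hδ : 0 < δ) (x : Site 3) :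
    rescaledCorrelator (criticalCorr 3) ρ 2 δ ![0, δ • siteVec x] =
      ρ δ ^ 2 * criticalTwoPoint 3 x := by
  rw [rescaledCorrelator_apply, ← criticalCorr_two]
  congr 2
  funext i
  fin_cases i
  · simp [latticeApprox_zero]
  · simpa using latticeApprox_smul_siteVec hδ x

/-- The mesh sequence `1/n → 0⁺`. [folklore] -/
theorem crossTerm_tendsto_mesh : Tendsto (fun n : ℕ => (n : ℝ)⁻¹) atTop (𝓝[>] (0 : ℝ)) :=
  tendsto_inv_atTop_nhdsGT_zero.comp tendsto_natCast_atTop_atTop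

/-! ### Uniform two-point asymptotics on the layer -/

/-- **The scaling limit read on one layer, uniformly.** Under an `O(3)`+scale-covariant pointwise
scaling limit, `ρ(1/n)² ⟨σ₀σ_y⟩_{β_c}` is within `ε` of `A (1+|x|²)^{−Δ}`, `A = S₂(0, e₀)`, for all
large `n`, uniformly over the lattice points `y` with `ŷ/n = (1, x)`, `x ∈ [-R, R]²`. [folklore] -/
theorem crossTerm_layer_uniform {ρ : ℝ → ℝ} {Δ : ℝ} {S : CorrFamily 3}
    (hlim : HasPointwiseScalingLimit (criticalCorr 3) ρ S) (hrot : IsRotationInvariant S)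
    (hsc : IsScaleCovariant Δ S) (R : ℕ) {ε : ℝ} (hε : 0 < ε) :
    ∀ᶠ n : ℕ in atTop, ∀ x ∈ Set.Icc (fun _ : Fin 2 => -(R : ℝ)) (fun _ => (R : ℝ)), ∀ y : Site 3,
      (n : ℝ)⁻¹ • siteVec y = (WithLp.toLp 2 (Fin.cons 1 x) : EuclideanSpace ℝ (Fin 3)) →
        |ρ ((n : ℝ)⁻¹) ^ 2 * criticalTwoPoint 3 y -
            S 2 ![0, EuclideanSpace.single 0 1] * (1 + ‖WithLp.toLp 2 x‖ ^ 2) ^ (-Δ)| < ε := by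
  set box : Set (Fin 2 → ℝ) := Set.Icc (fun _ : Fin 2 => -(R : ℝ)) (fun _ => (R : ℝ)) with hbox
  set K : Set (Fin 2 → EuclideanSpace ℝ (Fin 3)) :=
    (fun x : Fin 2 → ℝ => (![0, (WithLp.toLp 2 (Fin.cons 1 x) : EuclideanSpace ℝ (Fin 3))] :
      Fin 2 → EuclideanSpace ℝ (Fin 3))) '' box with hK
  have hKc : IsCompact K := by
    refine (isCompact_Icc : IsCompact box).image ?_
    refine continuous_pi fun i => ?_
    fin_cases i
    · simpa using continuous_const
    · simpa using crossTerm_continuous_lift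
  have hKs : K ⊆ NonCoincident 3 2 := by
    rintro _ ⟨x, -, rfl⟩
    exact pair_mem_nonCoincident (Ne.symm (crossTerm_lift_ne_zero x))
  have hU : TendstoUniformlyOn (rescaledCorrelator (criticalCorr 3) ρ 2) (S 2) (𝓝[>] 0) K :=
    (tendstoLocallyUniformlyOn_iff_forall_isCompact (isOpen_nonCoincident 3 2)).1 (hlim 2) K hKs hKc
  have hev := crossTerm_tendsto_mesh.eventually (Metric.tendstoUniformlyOn_iff.1 hU ε hε)
  filter_upwards [hev, eventually_ge_atTop 1] with n hn h1 x hx y hy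
  have hn' : (0:ℝ) < n := by exact_mod_cast h1
  have h := hn _ ⟨x, hx, rfl⟩
  dsimp only at h
  rw [← hy, crossTerm_rescaledCorrelator_pair ρ (inv_pos.2 hn') y, hy,
    two_point_radial hrot hsc (crossTerm_lift_ne_zero x), Real.dist_eq, abs_sub_comm] at h
  convert h using 3
  rw [mul_comm, show -(2:ℝ) * Δ = 2 * (-Δ) by ring, Real.rpow_mul (norm_nonneg _),
    Real.rpow_two, crossTerm_norm_lift_sq]

/-! ### The stub -/

/-- **Stub B1** (`stub_crossTermLimit`): under the crux hypotheses, for every continuous profile `φ`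
vanishing outside the ball of radius `R`,
`Σ_{u ∈ ℤ², |uᵢ| ≤ Rn} n⁻² φ(u/n) ⟨σ₀σ_{(n,u)}⟩_{β_c} / ⟨σ₀σ_{2n e₀}⟩_{β_c} → 4^Δ ∫ φ(v)(1+|v|²)^{−Δ} dv`.
[folklore] -/
theorem stub_crossTermLimit :
    ∀ (ρ : ℝ → ℝ) (Δ : ℝ) (S : CorrFamily 3), (∀ δ ∈ Set.Ioc (0:ℝ) 1, 0 < ρ δ) →
      HasPointwiseScalingLimit (criticalCorr 3) ρ S → IsNondegenerateTwoPoint S →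
      IsMoebiusCovariant Δ S →
      ∀ (φ : EuclideanSpace ℝ (Fin 2) → ℝ) (R : ℕ), Continuous φ →
        (∀ v : EuclideanSpace ℝ (Fin 2), (R : ℝ) ≤ ‖v‖ → φ v = 0) →
        Tendsto (fun n : ℕ =>
            (∑ u ∈ Fintype.piFinset (fun _ : Fin 2 => Finset.Icc (-((R * n : ℕ) : ℤ)) ((R * n : ℕ) : ℤ)),
              φ ((n : ℝ)⁻¹ • (WithLp.toLp 2 fun i => (u i : ℝ))) / (n : ℝ) ^ 2 *
                criticalTwoPoint 3 (Fin.cons (n : ℤ) u)) /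
            criticalTwoPoint 3 (Pi.single 0 ((2 * n : ℕ) : ℤ)))
          atTop (𝓝 ((4:ℝ) ^ Δ * ∫ v : EuclideanSpace ℝ (Fin 2), φ v * (1 + ‖v‖ ^ 2) ^ (-Δ))) := by
  intro ρ Δ S hρ hlim hnd hMo φ R hφc hφs
  have hrot : IsRotationInvariant S := hMo.isEuclideanInvariant.2
  have hsc : IsScaleCovariant Δ S := hMo.isScaleCovariant
  -- the amplitude `A = S₂(0, e₀) > 0`
  set A : ℝ := S 2 ![0, EuclideanSpace.single 0 1] with hAdef
  have hA : 0 < A := hnd _ (zero_unitVec_mem_nonCoincident one_ne_zero)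
  -- the continuum integrand
  set F : EuclideanSpace ℝ (Fin 2) → ℝ := fun v => φ v * (1 + ‖v‖ ^ 2) ^ (-Δ) with hFdef
  have hgc : Continuous fun v : EuclideanSpace ℝ (Fin 2) => (1 + ‖v‖ ^ 2) ^ (-Δ) := by
    refine Continuous.rpow_const (f := fun v : EuclideanSpace ℝ (Fin 2) => 1 + ‖v‖ ^ 2)
      (by fun_prop) fun v => Or.inl ?_
    have h : (0:ℝ) < 1 + ‖v‖ ^ 2 := by positivity
    exact h.ne'
  have hFc : Continuous F := hφc.mul hgc
  have hFs : ∀ v, (R : ℝ) ≤ ‖v‖ → F v = 0 := fun v hv => by simp [hFdef, hφs v hv]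
  -- (1) the denominator: `ρ(1/n)² G(2n e₀) → 2^{-2Δ} A`
  have hp : Tendsto (fun n : ℕ => ρ ((n:ℝ)⁻¹) ^ 2 * criticalTwoPoint 3 (Pi.single 0 ((2 * n : ℕ) : ℤ)))
      atTop (𝓝 ((2:ℝ) ^ (-(2:ℝ) * Δ) * A)) := by
    have hx : (![0, EuclideanSpace.single 0 2] : Fin 2 → EuclideanSpace ℝ (Fin 3)) ∈
        NonCoincident 3 2 := zero_unitVec_mem_nonCoincident two_ne_zero
    have h1 := ((hlim 2).tendsto_at hx).comp crossTerm_tendsto_mesh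
    have hne : (EuclideanSpace.single (0 : Fin 3) (2 : ℝ)) ≠ 0 := by
      intro h
      have := congrArg (fun v : EuclideanSpace ℝ (Fin 3) => v 0) h
      simp at this
    have hS : S 2 ![0, EuclideanSpace.single 0 2] = (2:ℝ) ^ (-(2:ℝ) * Δ) * A := by
      rw [two_point_radial hrot hsc hne, PiLp.norm_single, Real.norm_eq_abs, abs_two]
    rw [hS] at h1
    refine h1.congr' ?_
    filter_upwards [eventually_ge_atTop 1] with n hn
    have hn' : (0:ℝ) < n := by exact_mod_cast hn
    simp only [Function.comp_apply]
    rw [← crossTerm_smul_siteVec_axis hn, crossTerm_rescaledCorrelator_pair ρ (inv_pos.2 hn')]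
  -- (2) Riemann sums of `F` and of `|φ|`
  have hRF := crossTerm_tendsto_riemann_sum hFc R hFs
  have hRabs := crossTerm_tendsto_riemann_sum (F := fun v => |φ v|) hφc.abs R
    (fun v hv => by simp [hφs v hv])
  -- (3) the numerator: `Σ n⁻²φ(u/n) ρ(1/n)² G((n,u)) → A ∫ F`
  have hN : Tendsto (fun n : ℕ =>
      ∑ u ∈ Fintype.piFinset (fun _ : Fin 2 => Finset.Icc (-((R * n : ℕ) : ℤ)) ((R * n : ℕ) : ℤ)),
        φ ((n : ℝ)⁻¹ • (WithLp.toLp 2 fun i => (u i : ℝ))) / (n : ℝ) ^ 2 *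
          (ρ ((n:ℝ)⁻¹) ^ 2 * criticalTwoPoint 3 (Fin.cons (n : ℤ) u)))
      atTop (𝓝 (A * ∫ v, F v)) := by
    have hM := hRF.const_mul A
    -- the difference to `A ×` the Riemann sum of `F` tends to zero
    have hD : Tendsto (fun n : ℕ =>
        ∑ u ∈ Fintype.piFinset (fun _ : Fin 2 => Finset.Icc (-((R * n : ℕ) : ℤ)) ((R * n : ℕ) : ℤ)),
          φ ((n : ℝ)⁻¹ • (WithLp.toLp 2 fun i => (u i : ℝ))) / (n : ℝ) ^ 2 *
            (ρ ((n:ℝ)⁻¹) ^ 2 * criticalTwoPoint 3 (Fin.cons (n : ℤ) u)) -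
        A * ∑ u ∈ Fintype.piFinset (fun _ : Fin 2 => Finset.Icc (-((R * n : ℕ) : ℤ)) ((R * n : ℕ) : ℤ)),
          F ((n : ℝ)⁻¹ • (WithLp.toLp 2 fun i => (u i : ℝ))) / (n : ℝ) ^ 2)
        atTop (𝓝 0) := by
      rw [Metric.tendsto_nhds]
      intro ε hε
      set P : ℝ := ∫ v, |φ v| with hPdef
      have hP : 0 ≤ P := integral_nonneg fun v => abs_nonneg _
      have hε₁ : 0 < ε / (P + 1) := by positivity
      have hbd : ∀ᶠ n : ℕ in atTop,
          ∑ u ∈ Fintype.piFinset (fun _ : Fin 2 => Finset.Icc (-((R * n : ℕ) : ℤ)) ((R * n : ℕ) : ℤ)),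
            |φ ((n : ℝ)⁻¹ • (WithLp.toLp 2 fun i => (u i : ℝ)))| / (n : ℝ) ^ 2 < P + 1 :=
        hRabs.eventually (gt_mem_nhds (lt_add_one P))
      filter_upwards [hbd, crossTerm_layer_uniform hlim hrot hsc R hε₁, eventually_ge_atTop 1]
        with n hb hu hn
      rw [Real.dist_0_eq_abs, Finset.mul_sum, ← Finset.sum_sub_distrib]
      have hterm : ∀ u ∈ Fintype.piFinset
          (fun _ : Fin 2 => Finset.Icc (-((R * n : ℕ) : ℤ)) ((R * n : ℕ) : ℤ)),
          |φ ((n : ℝ)⁻¹ • (WithLp.toLp 2 fun i => (u i : ℝ))) / (n : ℝ) ^ 2 *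
              (ρ ((n:ℝ)⁻¹) ^ 2 * criticalTwoPoint 3 (Fin.cons (n : ℤ) u)) -
            A * (F ((n : ℝ)⁻¹ • (WithLp.toLp 2 fun i => (u i : ℝ))) / (n : ℝ) ^ 2)| ≤
          |φ ((n : ℝ)⁻¹ • (WithLp.toLp 2 fun i => (u i : ℝ)))| / (n : ℝ) ^ 2 * (ε / (P + 1)) := by
        intro u hu'
        have hx := crossTerm_smul_mem_box hn hu'
        have key := hu _ hx (Fin.cons (n : ℤ) u) (crossTerm_smul_siteVec_cons hn u)
        rw [WithLp.toLp_smul] at key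
        have hsplit : φ ((n : ℝ)⁻¹ • (WithLp.toLp 2 fun i => (u i : ℝ))) / (n : ℝ) ^ 2 *
              (ρ ((n:ℝ)⁻¹) ^ 2 * criticalTwoPoint 3 (Fin.cons (n : ℤ) u)) -
            A * (F ((n : ℝ)⁻¹ • (WithLp.toLp 2 fun i => (u i : ℝ))) / (n : ℝ) ^ 2) =
            φ ((n : ℝ)⁻¹ • (WithLp.toLp 2 fun i => (u i : ℝ))) / (n : ℝ) ^ 2 *
              (ρ ((n:ℝ)⁻¹) ^ 2 * criticalTwoPoint 3 (Fin.cons (n : ℤ) u) -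
                A * (1 + ‖(n : ℝ)⁻¹ • (WithLp.toLp 2 fun i => (u i : ℝ))‖ ^ 2) ^ (-Δ)) := by
          simp only [hFdef]; ring
        rw [hsplit, abs_mul, abs_div, abs_of_pos (by positivity : (0:ℝ) < (n:ℝ) ^ 2)]
        exact mul_le_mul_of_nonneg_left key.le (by positivity)
      calc |∑ u ∈ Fintype.piFinset (fun _ : Fin 2 => Finset.Icc (-((R * n : ℕ) : ℤ)) ((R * n : ℕ) : ℤ)),
              (φ ((n : ℝ)⁻¹ • (WithLp.toLp 2 fun i => (u i : ℝ))) / (n : ℝ) ^ 2 *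
                (ρ ((n:ℝ)⁻¹) ^ 2 * criticalTwoPoint 3 (Fin.cons (n : ℤ) u)) -
              A * (F ((n : ℝ)⁻¹ • (WithLp.toLp 2 fun i => (u i : ℝ))) / (n : ℝ) ^ 2))|
          ≤ ∑ u ∈ Fintype.piFinset (fun _ : Fin 2 => Finset.Icc (-((R * n : ℕ) : ℤ)) ((R * n : ℕ) : ℤ)),
              |φ ((n : ℝ)⁻¹ • (WithLp.toLp 2 fun i => (u i : ℝ)))| / (n : ℝ) ^ 2 * (ε / (P + 1)) :=
            (Finset.abs_sum_le_sum_abs _ _).trans (Finset.sum_le_sum hterm)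
        _ = (∑ u ∈ Fintype.piFinset (fun _ : Fin 2 => Finset.Icc (-((R * n : ℕ) : ℤ)) ((R * n : ℕ) : ℤ)),
              |φ ((n : ℝ)⁻¹ • (WithLp.toLp 2 fun i => (u i : ℝ)))| / (n : ℝ) ^ 2) * (ε / (P + 1)) := by
            rw [Finset.sum_mul]
        _ < (P + 1) * (ε / (P + 1)) := mul_lt_mul_of_pos_right hb hε₁
        _ = ε := by field_simp
    have := hD.add hM
    rw [zero_add] at this
    refine this.congr' (Eventually.of_forall fun n => ?_)
    simp only [sub_add_cancel]
  -- (4) assemble: divide numerator by denominator and cancel `ρ(1/n)²`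
  have hden : (2:ℝ) ^ (-(2:ℝ) * Δ) * A ≠ 0 := (mul_pos (Real.rpow_pos_of_pos two_pos _) hA).ne'
  have hmain := hN.div hp hden
  have hconst : A * (∫ v, F v) / ((2:ℝ) ^ (-(2:ℝ) * Δ) * A) = (4:ℝ) ^ Δ * ∫ v, F v := by
    rw [mul_comm ((2:ℝ) ^ (-(2:ℝ) * Δ)) A, mul_div_mul_left _ _ hA.ne',
      show -(2:ℝ) * Δ = -(2 * Δ) by ring, Real.rpow_neg two_pos.le, div_inv_eq_mul,
      Real.rpow_mul two_pos.le, Real.rpow_two, mul_comm]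
    norm_num
  rw [hconst] at hmain
  refine hmain.congr' ?_
  filter_upwards [eventually_ge_atTop 1] with n hn
  have hn' : (0:ℝ) < n := by exact_mod_cast hn
  have hρn : ρ ((n:ℝ)⁻¹) ^ 2 ≠ 0 :=
    (pow_pos (hρ _ ⟨inv_pos.2 hn', inv_le_one_of_one_le₀ (by exact_mod_cast hn)⟩) 2).ne'
  rw [← mul_div_mul_left _ (criticalTwoPoint 3 (Pi.single 0 ((2 * n : ℕ) : ℤ))) hρn, Finset.mul_sum,
    Pi.div_apply]
  congr 1
  refine Finset.sum_congr rfl fun u _ => ?_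
  ring

end Summit.CriticalPhenomena.Ising3DConformalLimit.Cruxes.GaussianLimitNotScreened.SingleLayerLinearRegression

end
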